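import Summits.QuantumFields.YangMills.Theorems.UnitScaleTiltProp8FlatPortGRowsL0
import Summits.QuantumFields.YangMills.Theorems.BalabanUVNodesK0FlatPortHRows34P
import HarnessLib

/-!
# K0⁷ `stub_prop8StepCoP13` (stmt-QuantumFields-20541), sub-target S5, S5 ROAD item (b) — the d-generic port, file P7 (twin of `UnitScaleTiltProp8FlatPortGRowsL0`):
# **THE `G`-ROWS OF THE P2 TEXT ON THE TORI `PV d ℓ m K`: the genuine propagator `G = Δ_a⁻¹ = GE` (pinned `IsFlatGW`) with the guarded `hG` letter `GtSupLetterG` and the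
# Laplacian letter `GtLaplaceLetterG` of `K0FlatCubeOpsTextP`, constant `A·L³·c₁`** — from lit-balaban's [Balaban1984PropagatorsII] Prop. 2.6 (2.136)₁,₂,₄ block majorants read
# through the level-0 chart, the level-absorbed row sum and Lemma 2.1 (2.61)

Cell `pub-ymgap`, width seat `pub-ymgap-k0-s1-w3` gen 2 (D-0149; START LIST v7 §k0-s1 «S5 ROAD LOCATED … UNOWNED ×3», item (b) = the d-GENERIC PORT re-run of the
ym3-torus bridge `UnitScaleTiltProp8FlatPort*L0`, plan g80 WORDS-1b l.25728).  `--kind proof --supports stmt-QuantumFields-20541 --as helper`; count-neutral; def-free.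
METHOD: the UST file is re-typed with the carrier `PV 2 ℓ m K ↦ PV d ℓ m K hd hL` (dimension `2 + 1 ↦ d + 1`, directions `Fin (d + 1)`), the P2 letters read in their
carrier-generic form `K0FlatCubeOpsTextP.*` at `(P, k) := (PV d ℓ m K hd hL, K − n)` (the `T3Family` binder and `hm : 1 ≤ m` disappear); proofs VERBATIM after the
substitution; every `D`-free ∕ carrier-free lemma of the UST files is consumed BY NAME (imports), nothing of theirs restated.  lit-balaban's k-level
[Balaban1984PropagatorsII] rows (`…KLevelV1L0`, generic in `d`) are the content, consumed by name.

WHAT IS PROVED (sorry-free; axioms standard; no definition; the carrier-generic level-absorbed row sum `FlatPortGRowsL0.rowSum3_le` is consumed BY NAME): **`gRows_of_portShapes`**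
(the three (2.136) majorants `hG`, `hDG`, `hLap` ⇒ `IsFlatGW … (onFun GE)` ∧ `GtSupLetterG … (A·L³·c₁)` ∧ `GtLaplaceLetterG … (A·L³·c₁)` for every P2 weight family).
THE PRINT.  [Balaban1984PropagatorsII] Prop. 2.6 (2.136) p. 247; [Balaban1985Variational] (158) p. 302, (165) p. 304 (the `G̃`-letters × Prop. 4).
HONEST FRAMING: count-neutral helper; nothing of [Balaban1985Variational] Sect. F itself is asserted; K0⁷ OPEN; N07 NOT discharged (5∕27 unmoved); one finite 𝕋⁴ programme
at fixed ε — R4 closes the conditional finite-𝕋⁴ rung `BalabanLadder.UV` only; the YM mass gap (Clay) is NOT proved by any of this; nothing continuum ∕ ℝ⁴ ∕ OS.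

References: T. Bałaban, CMP **96** (1984) 223–250 [Balaban1984PropagatorsII] Lemma 2.1 (2.60)–(2.61) p.234, Prop. 2.6 (2.136) p.247; CMP **102** (1985) 277–309 [Balaban1985Variational]
(158) p.302, (165) p.304.
-/

set_option autoImplicit false

noncomputable section

open scoped BigOperators

namespace Summit.QuantumFields.YangMills.Theorems.K0FlatPortGRowsP

open FlatPortGRows (abs_apply_le_sum_blocks)
open FlatPortGRowsL0 (rowSum3_le)

open Literature.MathematicalPhysics.QuantumFieldTheory.Balaban1983to89
open Literature.MathematicalPhysics.QuantumFieldTheory.BalabanImbrieJaffe1984to88.BIJ85AxialPropagator411 (BondSpace)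
open B6MultiLevelBoxOperator (N0)
open B6MultiLevelTorusOperatorL0 (TDomains)
open B6Geom246MultiLevelBoxL0 (bset)
open B6Geom246MultiLevelTorusL0 (geomT bondT)
open B6GlobalChartV1 (PV toBox)
open B6GlobalChartV1L0 (blkV1 domT)
open B6Ineq2133TwoScaleV1 (onFun onFun_apply)
open B6GradLegKLevelV1 (DV DV_apply)
open B6LapLegKLevelV1 (LapV LapV_apply)
open B6RandomWalk (HasMajorant BlockSupp blockPiece blockSupp_blockPiece sum_blockPiece)
open B6Lemma21Repaired (Ineq261With)
open B6Ineq281MultiLevelBoxL0 (lgap)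
open B6Prop26KLevelSkeletonV1L0 (pref)
open B6Cor28KLevelV1L0 (powL_lgap_le)
open B6SectAOperatorsV1 (BondIdx)
open B6SectAVectorModelV1 (GE)
open Summit.QuantumFields.YangMills.Theorems.K0FlatCubeOpsTextP (IsLevWeight GtSupLetterG GtLaplaceLetterG)
open Summit.QuantumFields.YangMills.Theorems.K0FlatCubeOpsTextP (IsFlatGW)
open FlatPortDistanceL0 (blkV1_level)
open FlatPortHRows12 (cf_ne_zero)
open K0FlatPortHRows34P (levWeight_eq pref_blkV1)


/-! ## The `G`-rows at a charted family (the block decomposition `FlatPortGRows.abs_apply_le_sum_blocks` and the level-absorbed row sum `FlatPortGRowsL0.rowSum3_le` are carrier-generic already, used by name) -/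

section Carrier

variable (d ℓ : ℕ) (hd : 1 ≤ d + 1) (hL : Odd (ℓ + 1) ∧ 1 < ℓ + 1) (m : ℕ) (n K : ℕ)
variable {Mh R : ℕ} {P' : Fin (d + 1) → ℕ}
variable (hN : ∀ μ, N0 ℓ Mh (K - n) P' μ = (PV d ℓ m K hd hL).sitesPerDir 0) (D : TDomains d ℓ Mh (K - n) P' R) (hk : K - n ≤ m + K)

/-- **THE `G`-ROWS OF `KernelRowsAt` FROM THE THREE (2.136) MAJORANTS.**  For units `c′ = L^{K−n}`, ANY positive weights `w♯`, the plain-function propagator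
`G := onFun (GE (domT hN D hk) c′ w♯)` is the pinned genuine propagator (`IsFlatGW`), and the (2.136)₁,₂,₄ majorants (constant `A ≥ 0`, rate `δ₃ ≥ 0`) with the threshold
`L³e^{−(δ₃/2)(R·L·M_h − 1)} ≤ 1` and (2.61) at rate `δ₃/2` give `GtSupLetterG F n K w G (A·L³·c₁)` and `GtLaplaceLetterG F n K w G (A·L³·c₁)` for every P2 weight family `w`.
[cite: Balaban1984PropagatorsII, Prop. 2.6 (2.136) p.247, (2.52) p.232, Lemma 2.1 (2.60)-(2.61) p.234; Balaban1985Variational, (117) p.295, (165) p.304] -/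
theorem gRows_of_portShapes (hMh : 1 ≤ Mh) (hP : ∀ μ, 1 ≤ P' μ) (hRM1 : 1 ≤ R * ((ℓ + 1) * Mh))
    {ws : BondIdx (B6GlobalChartV1L0.domT hN D hk) → ℝ} (hws : ∀ i, 0 < ws i) {A δ₃ c₁ : ℝ} (hA : 0 ≤ A) (hδ₃ : 0 ≤ δ₃)
    (hG : HasMajorant (g := geomT D) (blkV1 hN D) (onFun (GE (domT hN D hk) (cf_ne_zero ℓ n K) hws))
      (fun y y' => A * pref ((((ℓ + 1 : ℕ) : ℝ)) ^ (K - n)) y * Real.exp (-(δ₃ * (geomT D).dist y y'))))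
    (hDG : ∀ ν : Fin (d + 1), HasMajorant (g := geomT D) (blkV1 hN D) (DV ν ((((ℓ + 1 : ℕ) : ℝ)) ^ (K - n)) ∘ₗ onFun (GE (domT hN D hk) (cf_ne_zero ℓ n K) hws))
      (fun y y' => A * ((geomT D).len y * |(((ℓ + 1 : ℕ) : ℝ)) ^ (K - n)|⁻¹) * Real.exp (-(δ₃ * (geomT D).dist y y'))))
    (hLap : HasMajorant (g := geomT D) (blkV1 hN D) (LapV ((((ℓ + 1 : ℕ) : ℝ)) ^ (K - n)) ∘ₗ onFun (GE (domT hN D hk) (cf_ne_zero ℓ n K) hws))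
      (fun y y' => A * Real.exp (-(δ₃ * (geomT D).dist y y'))))
    (hsmall : ((ℓ : ℝ) + 1) ^ 3 * Real.exp (-(δ₃ / 2 * ((R : ℝ) * (((ℓ : ℝ) + 1) * Mh) - 1))) ≤ 1) (h261 : Ineq261With c₁ (geomT D) δ₃ (1 / 2))
    (w : ℕ → PBond (PV d ℓ m K hd hL) 0 → ℝ) (hw : IsLevWeight (PV d ℓ m K hd hL) (K - n) (domT hN D hk) w) :
    IsFlatGW (PV d ℓ m K hd hL) (K - n) (domT hN D hk) hws (onFun (GE (domT hN D hk) (cf_ne_zero ℓ n K) hws)) ∧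
      GtSupLetterG (PV d ℓ m K hd hL) (K - n) w (onFun (GE (domT hN D hk) (cf_ne_zero ℓ n K) hws)) (A * ((ℓ : ℝ) + 1) ^ 3 * c₁) ∧
      GtLaplaceLetterG (PV d ℓ m K hd hL) (K - n) w (onFun (GE (domT hN D hk) (cf_ne_zero ℓ n K) hws)) (A * ((ℓ : ℝ) + 1) ^ 3 * c₁) := by
  -- notation
  set cf : ℝ := (((ℓ + 1 : ℕ) : ℝ)) ^ (K - n) with hcf
  set G := onFun (GE (domT hN D hk) (cf_ne_zero ℓ n K) hws) with hGdef
  have hL0 : (0 : ℝ) < ((ℓ + 1 : ℕ) : ℝ) := by exact_mod_cast Nat.succ_pos ℓ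
  have hL1 : (1 : ℝ) ≤ ((ℓ + 1 : ℕ) : ℝ) := by exact_mod_cast Nat.succ_le_succ (Nat.zero_le ℓ)
  have hcast : (((ℓ + 1 : ℕ) : ℝ)) = (ℓ : ℝ) + 1 := by push_cast; ring
  have hcf0 : 0 < cf := pow_pos hL0 _
  have hFL : ((((PV d ℓ m K hd hL).L : ℕ) : ℝ)) = ((ℓ + 1 : ℕ) : ℝ) := rfl
  -- the level of a fine bond and its powers
  have hLj : ∀ b : PBond (PV d ℓ m K hd hL) 0, (0 : ℝ) < (((ℓ + 1 : ℕ) : ℝ)) ^ D.lev (toBox hN b.src : Fin (d + 1) → ℤ) := fun b => pow_pos hL0 _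
  have hLjcf : ∀ b : PBond (PV d ℓ m K hd hL) 0, (((ℓ + 1 : ℕ) : ℝ)) ^ D.lev (toBox hN b.src : Fin (d + 1) → ℤ) ≤ cf :=
    fun b => pow_le_pow_right₀ hL1 (D.lev_le _)
  -- the data sizes per block: `w₃(b′)|f(b′)| ≤ β ⇒ |f(b′)| ≤ β·(c′/L^{j(b′)})³`
  have hdata : ∀ {f : PBond (PV d ℓ m K hd hL) 0 → ℝ} {β : ℝ}, 0 ≤ β → (∀ b, w 3 b * |f b| ≤ β) →
      ∀ b', |f b'| ≤ (fun y' : ↥(bset D.toDomains) => β * (cf / (((ℓ + 1 : ℕ) : ℝ)) ^ y'.1.1) ^ 3) (blkV1 hN D b') := by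
    intro f β hβ hf b'
    have hw3 : w 3 b' = ((((ℓ + 1 : ℕ) : ℝ)) ^ D.lev (toBox hN b'.src : Fin (d + 1) → ℤ) / cf) ^ 3 := levWeight_eq d ℓ hd hL m n K hN D hk hw 3 b'
    have hq : 0 < ((((ℓ + 1 : ℕ) : ℝ)) ^ D.lev (toBox hN b'.src : Fin (d + 1) → ℤ) / cf) ^ 3 := by positivity
    have h1 := hf b'
    rw [hw3] at h1
    show |f b'| ≤ β * (cf / (((ℓ + 1 : ℕ) : ℝ)) ^ D.lev (toBox hN b'.src : Fin (d + 1) → ℤ)) ^ 3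
    rw [← le_div_iff₀' hq] at h1
    refine h1.trans (le_of_eq ?_)
    rw [div_pow, div_pow, div_div_eq_mul_div, mul_div_assoc]
  -- the common row sum, per fine bond `b`
  have hrow : ∀ b : PBond (PV d ℓ m K hd hL) 0,
      ∑ y' : ↥(bset D.toDomains), Real.exp (-(δ₃ * (geomT D).dist (blkV1 hN D b) y')) *
          ((((ℓ + 1 : ℕ) : ℝ)) ^ D.lev (toBox hN b.src : Fin (d + 1) → ℤ)) ^ 3 / ((((ℓ + 1 : ℕ) : ℝ)) ^ y'.1.1) ^ 3 ≤ ((ℓ : ℝ) + 1) ^ 3 * c₁ :=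
    fun b => rowSum3_le D hMh hP hRM1 hδ₃ hsmall h261 (blkV1 hN D b)
  -- the three bounds share the computation `(L^j/c′)³·Σ K·B = A·β·Σ e^{−δd}L^{3j}/L^{3j′}`
  have hkey : ∀ {f : PBond (PV d ℓ m K hd hL) 0 → ℝ} {β : ℝ}, 0 ≤ β → (∀ b, w 3 b * |f b| ≤ β) → ∀ (b : PBond (PV d ℓ m K hd hL) 0) (p : ℕ), p ≤ 3 →
      ∀ {T : Module.End ℝ (PBond (PV d ℓ m K hd hL) 0 → ℝ)},
      HasMajorant (g := geomT D) (blkV1 hN D) T (fun y y' => A * ((((ℓ + 1 : ℕ) : ℝ)) ^ y.1.1 / cf) ^ p * Real.exp (-(δ₃ * (geomT D).dist y y'))) →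
      ((((ℓ + 1 : ℕ) : ℝ)) ^ D.lev (toBox hN b.src : Fin (d + 1) → ℤ) / cf) ^ (3 - p) * |T f b| ≤ A * ((ℓ : ℝ) + 1) ^ 3 * c₁ * β := by
    intro f β hβ hf b p hp T hT
    have h0 := abs_apply_le_sum_blocks (g := geomT D) (blkV1 hN D) hT (fun y' : ↥(bset D.toDomains) => β * (cf / (((ℓ + 1 : ℕ) : ℝ)) ^ y'.1.1) ^ 3)
      (fun y' => by positivity) (hdata hβ hf) b
    have hlev : (blkV1 hN D b).1.1 = D.lev (toBox hN b.src : Fin (d + 1) → ℤ) := rfl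
    simp only [hlev] at h0
    have hLj0 : 0 < (((ℓ + 1 : ℕ) : ℝ)) ^ D.lev (toBox hN b.src : Fin (d + 1) → ℤ) := hLj b
    refine (mul_le_mul_of_nonneg_left h0 (by positivity)).trans ?_
    rw [Finset.mul_sum]
    -- termwise: `(Lj/cf)^{3−p}·(A(Lj/cf)^p e^{−δd})·β(cf/Lj′)³ = Aβ·e^{−δd}·Lj³/Lj′³`
    have hterm : ∀ y' : ↥(bset D.toDomains),
        ((((ℓ + 1 : ℕ) : ℝ)) ^ D.lev (toBox hN b.src : Fin (d + 1) → ℤ) / cf) ^ (3 - p) *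
            (A * ((((ℓ + 1 : ℕ) : ℝ)) ^ D.lev (toBox hN b.src : Fin (d + 1) → ℤ) / cf) ^ p * Real.exp (-(δ₃ * (geomT D).dist (blkV1 hN D b) y')) *
              (β * (cf / (((ℓ + 1 : ℕ) : ℝ)) ^ y'.1.1) ^ 3)) =
          A * β * (Real.exp (-(δ₃ * (geomT D).dist (blkV1 hN D b) y')) *
            ((((ℓ + 1 : ℕ) : ℝ)) ^ D.lev (toBox hN b.src : Fin (d + 1) → ℤ)) ^ 3 / ((((ℓ + 1 : ℕ) : ℝ)) ^ y'.1.1) ^ 3) := by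
      intro y'
      have hy0 : (((ℓ + 1 : ℕ) : ℝ)) ^ y'.1.1 ≠ 0 := pow_ne_zero _ hL0.ne'
      have hc : cf ≠ 0 := hcf0.ne'
      have hpow : ((((ℓ + 1 : ℕ) : ℝ)) ^ D.lev (toBox hN b.src : Fin (d + 1) → ℤ) / cf) ^ (3 - p) *
          ((((ℓ + 1 : ℕ) : ℝ)) ^ D.lev (toBox hN b.src : Fin (d + 1) → ℤ) / cf) ^ p =
          ((((ℓ + 1 : ℕ) : ℝ)) ^ D.lev (toBox hN b.src : Fin (d + 1) → ℤ) / cf) ^ 3 := by rw [← pow_add, Nat.sub_add_cancel hp]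
      calc ((((ℓ + 1 : ℕ) : ℝ)) ^ D.lev (toBox hN b.src : Fin (d + 1) → ℤ) / cf) ^ (3 - p) *
            (A * ((((ℓ + 1 : ℕ) : ℝ)) ^ D.lev (toBox hN b.src : Fin (d + 1) → ℤ) / cf) ^ p * Real.exp (-(δ₃ * (geomT D).dist (blkV1 hN D b) y')) *
              (β * (cf / (((ℓ + 1 : ℕ) : ℝ)) ^ y'.1.1) ^ 3))
          = A * β * Real.exp (-(δ₃ * (geomT D).dist (blkV1 hN D b) y')) *
              ((((((ℓ + 1 : ℕ) : ℝ)) ^ D.lev (toBox hN b.src : Fin (d + 1) → ℤ) / cf) ^ (3 - p) *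
                ((((ℓ + 1 : ℕ) : ℝ)) ^ D.lev (toBox hN b.src : Fin (d + 1) → ℤ) / cf) ^ p) * (cf / (((ℓ + 1 : ℕ) : ℝ)) ^ y'.1.1) ^ 3) := by ring
        _ = A * β * Real.exp (-(δ₃ * (geomT D).dist (blkV1 hN D b) y')) *
              (((((ℓ + 1 : ℕ) : ℝ)) ^ D.lev (toBox hN b.src : Fin (d + 1) → ℤ) / cf) ^ 3 * (cf / (((ℓ + 1 : ℕ) : ℝ)) ^ y'.1.1) ^ 3) := by rw [hpow]
        _ = _ := by field_simp
    refine (Finset.sum_le_sum fun y' _ => (hterm y').le).trans ?_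
    rw [← Finset.mul_sum]
    calc A * β * ∑ y', Real.exp (-(δ₃ * (geomT D).dist (blkV1 hN D b) y')) *
          ((((ℓ + 1 : ℕ) : ℝ)) ^ D.lev (toBox hN b.src : Fin (d + 1) → ℤ)) ^ 3 / ((((ℓ + 1 : ℕ) : ℝ)) ^ y'.1.1) ^ 3
        ≤ A * β * (((ℓ : ℝ) + 1) ^ 3 * c₁) := mul_le_mul_of_nonneg_left (hrow b) (by positivity)
      _ = A * ((ℓ : ℝ) + 1) ^ 3 * c₁ * β := by ring
  refine ⟨fun f b => rfl, ?_, ?_⟩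
  · -- `GtSupLetterG`: the sup row (`p = 2`) and the gradient row (`p = 1` after reading `len/|c′|`)
    intro f β hβ hf
    refine ⟨fun b => ?_, fun b ν => ?_⟩
    · have hw1 : w 1 b = ((((ℓ + 1 : ℕ) : ℝ)) ^ D.lev (toBox hN b.src : Fin (d + 1) → ℤ) / cf) ^ 1 := levWeight_eq d ℓ hd hL m n K hN D hk hw 1 b
      have hG' : HasMajorant (g := geomT D) (blkV1 hN D) G (fun y y' => A * ((((ℓ + 1 : ℕ) : ℝ)) ^ y.1.1 / cf) ^ 2 * Real.exp (-(δ₃ * (geomT D).dist y y'))) := hG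
      have h1 := hkey hβ hf b 2 (by norm_num) hG'
      rw [hw1]
      exact h1
    · have hw2 : w 2 b = ((((ℓ + 1 : ℕ) : ℝ)) ^ D.lev (toBox hN b.src : Fin (d + 1) → ℤ) / cf) ^ 2 := levWeight_eq d ℓ hd hL m n K hN D hk hw 2 b
      -- the gradient majorant in the `(L^j/c′)^1` form
      have hDG' : HasMajorant (g := geomT D) (blkV1 hN D) (DV ν cf ∘ₗ G) (fun y y' => A * ((((ℓ + 1 : ℕ) : ℝ)) ^ y.1.1 / cf) ^ 1 * Real.exp (-(δ₃ * (geomT D).dist y y'))) := by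
        intro y' μ B hB x
        have h := hDG ν y' μ B hB x
        dsimp only at h
        have hlen : (geomT D).len (blkV1 hN D x) * |cf|⁻¹ = ((((ℓ + 1 : ℕ) : ℝ)) ^ (blkV1 hN D x).1.1 / cf) ^ 1 := by
          rw [pow_one, abs_of_pos hcf0, div_eq_mul_inv]
          congr 1
          show ((ℓ : ℝ) + 1) ^ (blkV1 hN D x).1.1 * 1 = _
          rw [mul_one, hcast]
        rw [hlen] at h
        exact h
      have h1 := hkey hβ hf b 1 (by norm_num) hDG'
      rw [LinearMap.comp_apply, DV_apply, abs_mul, abs_of_pos hcf0] at h1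
      rw [hw2]
      change ((((ℓ + 1 : ℕ) : ℝ)) ^ D.lev (toBox hN b.src : Fin (d + 1) → ℤ) / cf) ^ 2 * cf * |G f ⟨b.src.shift ν, b.dir⟩ - G f b| ≤ A * ((ℓ : ℝ) + 1) ^ 3 * c₁ * β
      calc ((((ℓ + 1 : ℕ) : ℝ)) ^ D.lev (toBox hN b.src : Fin (d + 1) → ℤ) / cf) ^ 2 * cf * |G f ⟨b.src.shift ν, b.dir⟩ - G f b|
          = ((((ℓ + 1 : ℕ) : ℝ)) ^ D.lev (toBox hN b.src : Fin (d + 1) → ℤ) / cf) ^ (3 - 1) * (cf * |G f ⟨b.src.shift ν, b.dir⟩ - G f b|) := by ring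
        _ ≤ A * ((ℓ : ℝ) + 1) ^ 3 * c₁ * β := h1
  · -- `GtLaplaceLetterG` (`p = 0`)
    intro f β hβ hf b
    have hw3 : w 3 b = ((((ℓ + 1 : ℕ) : ℝ)) ^ D.lev (toBox hN b.src : Fin (d + 1) → ℤ) / cf) ^ 3 := levWeight_eq d ℓ hd hL m n K hN D hk hw 3 b
    have hLap' : HasMajorant (g := geomT D) (blkV1 hN D) (LapV cf ∘ₗ G) (fun y y' => A * ((((ℓ + 1 : ℕ) : ℝ)) ^ y.1.1 / cf) ^ 0 * Real.exp (-(δ₃ * (geomT D).dist y y'))) := by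
      intro y' μ B hB x
      have h := hLap y' μ B hB x
      dsimp only at h ⊢
      rw [pow_zero, mul_one]
      exact h
    have h1 := hkey hβ hf b 0 (by norm_num) hLap'
    rw [LinearMap.comp_apply, LapV_apply, abs_mul, abs_of_pos (pow_pos hcf0 2)] at h1
    have hst : ∑ ν : Fin (d + 1), ((G f b - G f ⟨b.src.shift ν, b.dir⟩) + (G f b - G f ⟨b.src.unshift ν, b.dir⟩)) =
        ∑ ν : Fin (d + 1), (2 * G f b - G f ⟨b.src.unshift ν, b.dir⟩ - G f ⟨b.src.shift ν, b.dir⟩) :=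
      Finset.sum_congr rfl fun ν _ => by ring
    rw [hw3]
    change ((((ℓ + 1 : ℕ) : ℝ)) ^ D.lev (toBox hN b.src : Fin (d + 1) → ℤ) / cf) ^ 3 * cf ^ 2 *
        |∑ ν : Fin (d + 1), ((G f b - G f ⟨b.src.shift ν, b.dir⟩) + (G f b - G f ⟨b.src.unshift ν, b.dir⟩))| ≤ A * ((ℓ : ℝ) + 1) ^ 3 * c₁ * β
    rw [hst]
    calc ((((ℓ + 1 : ℕ) : ℝ)) ^ D.lev (toBox hN b.src : Fin (d + 1) → ℤ) / cf) ^ 3 * cf ^ 2 *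
          |∑ ν : Fin (d + 1), (2 * G f b - G f ⟨b.src.unshift ν, b.dir⟩ - G f ⟨b.src.shift ν, b.dir⟩)|
        = ((((ℓ + 1 : ℕ) : ℝ)) ^ D.lev (toBox hN b.src : Fin (d + 1) → ℤ) / cf) ^ (3 - 0) *
          (cf ^ 2 * |∑ ν : Fin (d + 1), (2 * G f b - G f ⟨b.src.unshift ν, b.dir⟩ - G f ⟨b.src.shift ν, b.dir⟩)|) := by ring
      _ ≤ A * ((ℓ : ℝ) + 1) ^ 3 * c₁ * β := h1

end Carrier

end Summit.QuantumFields.YangMills.Theorems.K0FlatPortGRowsP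

end
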